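import Summits.BirchSwinnertonDyer.BirchSwinnertonDyer.Theses.UniversalToricDescent
import Summits.BirchSwinnertonDyer.BirchSwinnertonDyer.Theorems.UniversalToricDescentSigmaCongruenceOfEqualProfiles
import Summits.BirchSwinnertonDyer.BirchSwinnertonDyer.Theorems.UniversalToricDescentSelfMuZeroAtThree
import HarnessLib

/-!
# Route UniversalToricDescent, crux ♭T≤ `DefectTransportModThreePT` (stmt-BirchSwinnertonDyer-23042): its research
# residue A `SigmaCongruenceAtThree` (stmt-BirchSwinnertonDyer-27120) BY NAME ⟺ the INVARIANT-PAIR form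
# «`μ(𝓛) = 0`, and `λ(𝓛) + Σ_{v∈T} 3^{c_v}·d_v(E_K) = λ(𝓛′) + Σ_{v∈T} 3^{c_v}·d_v(E′_K)`» (given `μ(𝓛′) = 0`)

Width prover bsd-wall-utd-p1-w2 g5 (`--supports stmt-BirchSwinnertonDyer-27120`, helper; sequel of
`UniversalToricDescentSigmaCongruenceOfEqualProfiles`, whose §3 `exists_isUnit_sigmaCongruence_of_normProfile` is the
(←) half; the (→) half is utd-p1 g12's `UniversalToricDescentDefectTransport.exists_normProfile_of_sigmaCongruence`,
p616991). A RESTATEMENT CERTIFICATE for the planner: the filed text of A concludes «`∃ e u`, `u` a unit of `R₀⟦T⟧`,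
`e_v ≠ 0`, `v_3(e_v) = c_v`, `𝓛·∏_{v∈T}P_v(q_v⁻¹(1+T)^{e_v}) ≡ u·𝓛′·∏_{v∈T}P′_v(q_v⁻¹(1+T)^{e_v}) (mod 𝔪_{R₀})`
coefficientwise»; this file proves it EQUIVALENT (same binders) to «`∃ m m′`: `𝓛` has norm profile `m`, `𝓛′` has
norm profile `m′`, `m + Σ_{v∈T} 3^{c_v}·d_v(E_K) = m′ + Σ_{v∈T} 3^{c_v}·d_v(E′_K)`» — Greenberg–Vatsal's
`(μ, λ)`-transport for the Σ-depleted BDP frames (Thm. (1.5) + display (9): `λ(L^Σ) = λ(L) + Σ_v λ(𝒫_v)`,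
`λ(𝒫_v) = 3^{c_v}·d_v` with `d_v` = multiplicity of `q_v⁻¹` as a root of the reduced Euler factor, Prop. (2.4)).
The exponents `e_v` and the unit `u` carry no information (`e_v := 3^{c_v}` always serves).

* §4 `sigmaCongruenceAtThree_iff_invariantPair` — A ⟺ invariant-pair form (unconditional).
* §5 `sigmaCongruenceAtThree_iff_lambdaIdentity_of_thmB` — GRANTED the refereed named fact Hsieh 2014 Thm. B
  (`Hsieh2014.thmB_exists_isHsiehLFunction_coeff_norm_eq_one_unrPeriod_anyLevel`, which yields `μ(𝓛) = 0` for every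
  frame of `f_E` by utd-p1 g4's `UniversalToricDescentSelfMuZero.self_forall_isBDPLFunction_coeff_norm_eq_one`),
  A ⟺ the pure ∀-form λ-IDENTITY «every profile `m` of `𝓛` and `m′` of `𝓛′` satisfy
  `m + Σ_{v∈T} 3^{c_v}·d_v(E_K) = m′ + Σ_{v∈T} 3^{c_v}·d_v(E′_K)`»: modulo print, the research content of A (hence of
  ♭T≤ 23042) is `λ(𝓛^Σ_E) = λ(𝓛^Σ_{E′})` for the Σ-depleted BDP frames of the `3`-congruent pair, nothing more.

THEOREMS ONLY; no definition, no named fact minted (Hsieh Thm. B enters §5 as a displayed hypothesis), no `sorry`;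
A itself stays OPEN (unprinted at `27 ∣ N`). BSD is not advanced by this file.
References: [GreenbergVatsal2000] Thm. (1.5), §1 display (9), §2 Prop. (2.4); [LeiMullerXia2023] Cor. 3.8, Thm. B;
[Hsieh2014] Thm. B; [Washington1997] §7.1.
-/

set_option autoImplicit false
-- `…BirchSwinnertonDyer.BirchSwinnertonDyer.Theorems…` is the problem's mandated namespace (D-0017).
set_option linter.dupNamespace false

noncomputable section

open scoped Classical

namespace Summit.BirchSwinnertonDyer.BirchSwinnertonDyer.Theorems.UniversalToricDescentSigmaCongruenceInvariantPair

open NumberField IsDedekindDomain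
open Literature.NumberTheory.EllipticCurves Literature.NumberTheory.EllipticCurves.GreenbergVatsal2000
  Summit.BirchSwinnertonDyer.Rank1Residual.X11b
  Summit.BirchSwinnertonDyer.BirchSwinnertonDyer.Theorems.UniversalToricDescentNormProfile
  Summit.BirchSwinnertonDyer.BirchSwinnertonDyer.Theorems.UniversalToricDescentDefectTransport
  Summit.BirchSwinnertonDyer.BirchSwinnertonDyer.Theses.UniversalToricDescent

/-- `3^c ∈ ℤ₃` is non-zero of valuation `c` (the canonical exponent of exact index `c`). [folklore] -/
theorem pow_three_ne_zero_and_valuation (c : ℕ) :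
    (3 : ℤ_[3]) ^ c ≠ 0 ∧ ((3 : ℤ_[3]) ^ c).valuation = c := by
  haveI : Fact (Nat.Prime 3) := ⟨Nat.prime_three⟩
  refine ⟨pow_ne_zero _ (by norm_num), ?_⟩
  have h3 : (3 : ℤ_[3]).valuation = 1 := by
    have h := PadicInt.valuation_p (p := 3)
    simpa using h
  rw [PadicInt.valuation_pow, h3, mul_one]

/-- Members of the bad set `T = {v ∤ 3 : E_K or E′_K bad at v}` do not divide `3`. [folklore] -/
theorem not_mem_of_coe_eq {K : Type} [Field K] [NumberField K] {T : Finset (HeightOneSpectrum (𝓞 K))}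
    {P : HeightOneSpectrum (𝓞 K) → Prop}
    (hT : (↑T : Set (HeightOneSpectrum (𝓞 K))) = {v | ((3 : ℕ) : 𝓞 K) ∉ v.asIdeal ∧ P v}) :
    ∀ v ∈ T, ((3 : ℕ) : 𝓞 K) ∉ v.asIdeal := by
  intro v hv
  have h : v ∈ (↑T : Set (HeightOneSpectrum (𝓞 K))) := Finset.mem_coe.mpr hv
  rw [hT] at h
  exact h.1

/-- **`SigmaCongruenceAtThree` (stmt-BirchSwinnertonDyer-27120, the research residue A of ♭T≤ 23042) is EQUIVALENT
to its INVARIANT-PAIR form.** Same binders (O6 wild curve `E` with `ρ̄₃` onto and `r_an = 1`, `3`-congruent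
non-additive twin `E′`, strict Heegner `K` for `N, N′`, anticyclotomic `κ`, generator `γ`, degree-one `𝔭 ∋ 3` and
the other slot `𝔭′`, branch `ι′`, frames `𝓛, 𝓛′` of `f_E, f_{E′}` with `μ(𝓛′) = 0`, the bad set `T` of places
`v ∤ 3` with exact indices `c_v`); the filed conclusion «`∃ e u`, `u` a unit, `e_v ≠ 0`, `v_3(e_v) = c_v`,
`𝓛·∏_{v∈T}P_v(q_v⁻¹(1+T)^{e_v}) ≡ u·𝓛′·∏_{v∈T}P′_v(q_v⁻¹(1+T)^{e_v}) (mod 𝔪_{R₀})` coefficientwise» holds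
IFF «`∃ m m′`: `𝓛` has norm profile `m` (`μ(𝓛) = 0`, `λ(𝓛) = m`), `𝓛′` has norm profile `m′`, and
`m + Σ_{v∈T} 3^{c_v}·d_v(E_K) = m′ + Σ_{v∈T} 3^{c_v}·d_v(E′_K)`» with `d_v(·)` the multiplicity of `q_v⁻¹` as a
root of the reduced Euler factor `P̃_v` (Greenberg–Vatsal's `d_ℓ`; `3^{c_v}·d_v = λ(𝒫_v)` = the local λ-defect
`#places over v × d_v`). (→) `exists_normProfile_of_sigmaCongruence` (utd-p1 g12) with `v_3(e_v) = c_v`;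
(←) §3 with the canonical exponents `e_v := 3^{c_v}`. So A is Greenberg–Vatsal's `(μ, λ)`-TRANSPORT for the
Σ-depleted BDP frames at the wild prime and nothing more; the unit `u` and the exponents `e_v` are inessential.
A restatement certificate (A itself stays OPEN / unprinted at `27 ∣ N`).
[cite: GreenbergVatsal2000, Thm. (1.5), §1 display (9), §2 Prop. (2.4)] [cite: LeiMullerXia2023, Cor. 3.8, Thm. B]
[cite: Washington1997, §7.1] -/
theorem sigmaCongruenceAtThree_iff_invariantPair :
    SigmaCongruenceAtThree ↔
      ∀ (W : WeierstrassCurve ℚ) [W.IsElliptic] [W.IsGloballyMinimal] (W' : WeierstrassCurve ℚ) [W'.IsElliptic]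
      [W'.IsGloballyMinimal] (N N' : ℕ) [NeZero N] [NeZero N'] (K : Type) [Field K] [NumberField K] (Dt :
      Literature.NumberTheory.EllipticCurves.ModularForms.ModularParametrizationData W N) (Dt' :
      Literature.NumberTheory.EllipticCurves.ModularForms.ModularParametrizationData W' N'),
      Summit.BirchSwinnertonDyer.Rank1Residual.Additive.ClassO6 W 3 → W.HasSurjectiveModNGaloisRep 3 →
      W.analyticRank = 1 → W.conductorNorm ℤ = N → Summit.BirchSwinnertonDyer.Rank1Residual.O6.ModPCongruent W' W
      3 → ¬ Literature.NumberTheory.EllipticCurves.Rank1Residual.Addv W' 3 → W'.conductorNorm ℤ = N' →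
      Literature.NumberTheory.EllipticCurves.IsImaginaryQuadratic K →
      Literature.NumberTheory.EllipticCurves.SatisfiesHeegnerHypothesis N K →
      Literature.NumberTheory.EllipticCurves.SatisfiesHeegnerHypothesis N' K → ∀ (κ :
      Literature.NumberTheory.EllipticCurves.ZpExtension K 3), κ.IsAnticyclotomic → ∀ (γ :
      Field.absoluteGaloisGroup K) [Fact (κ.IsTopGenerator γ)] (𝔭 : IsDedekindDomain.HeightOneSpectrum
      (NumberField.RingOfIntegers K)), ((3 : ℕ) : NumberField.RingOfIntegers K) ∈ 𝔭.asIdeal →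
      𝔭.asIdeal.ramificationIdx (NumberField.RingOfIntegers ℚ) = 1 → 𝔭.asIdeal.inertiaDeg
      (NumberField.RingOfIntegers ℚ) = 1 → ∀ (𝔭' : IsDedekindDomain.HeightOneSpectrum (NumberField.RingOfIntegers
      K)), ((3 : ℕ) : NumberField.RingOfIntegers K) ∈ 𝔭'.asIdeal → 𝔭' ≠ 𝔭 → ∀ (ι' : PadicAlgCl 3 ≃+* ℂ),
      Summit.BirchSwinnertonDyer.BirchSwinnertonDyer.Theorems.SchneiderFree.BranchInducesPrime 3 ι' 𝔭 → ∀ (ΩK : ℂ)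
      (Ωp : ℂ_[3]) (L : Literature.NumberTheory.EllipticCurves.UnrSeries 3), ΩK ≠ 0 → Ωp ≠ 0 →
      Literature.NumberTheory.EllipticCurves.IsBDPLFunction ι' 𝔭 κ γ Dt.f ΩK Ωp L → ∀ (ΩK' : ℂ) (Ωp' : ℂ_[3]) (L'
      : Literature.NumberTheory.EllipticCurves.UnrSeries 3), ΩK' ≠ 0 → Ωp' ≠ 0 →
      Literature.NumberTheory.EllipticCurves.IsBDPLFunction ι' 𝔭 κ γ Dt'.f ΩK' Ωp' L' → (∃ i : ℕ,
      ‖((PowerSeries.coeff i L' : Literature.NumberTheory.EllipticCurves.unrIntegers 3) : ℂ_[3])‖ = 1) → ∀ (T :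
      Finset (IsDedekindDomain.HeightOneSpectrum (NumberField.RingOfIntegers K))) (c :
      IsDedekindDomain.HeightOneSpectrum (NumberField.RingOfIntegers K) → ℕ), (↑T = {v :
      IsDedekindDomain.HeightOneSpectrum (NumberField.RingOfIntegers K) | ((3 : ℕ) : NumberField.RingOfIntegers K)
      ∉ v.asIdeal ∧ (¬ (W.baseChange K).HasGoodReductionAt v ∨ ¬ (W'.baseChange K).HasGoodReductionAt v)}) → (∀ v
      ∈ T, (∃ d₀ : Literature.NumberTheory.EllipticCurves.GreenbergSelmer.decomp (K := K) v, (κ (d₀ :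
      Field.absoluteGaloisGroup K)).toAdd = (3 : ℤ_[3]) ^ c v) ∧ (∀ d :
      Literature.NumberTheory.EllipticCurves.GreenbergSelmer.decomp (K := K) v, (3 : ℤ_[3]) ^ c v ∣ (κ (d :
      Field.absoluteGaloisGroup K)).toAdd)) →
      ∃ m m' : ℕ,
        ((∀ i < m, ‖((PowerSeries.coeff i L : unrIntegers 3) : ℂ_[3])‖ < 1) ∧
          ‖((PowerSeries.coeff m L : unrIntegers 3) : ℂ_[3])‖ = 1) ∧
        ((∀ i < m', ‖((PowerSeries.coeff i L' : unrIntegers 3) : ℂ_[3])‖ < 1) ∧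
          ‖((PowerSeries.coeff m' L' : unrIntegers 3) : ℂ_[3])‖ = 1) ∧
        m + ∑ v ∈ T, 3 ^ c v * (eulerFactorModP (W.baseChange K) 3 v).rootMultiplicity
              (((Nat.card (IsLocalRing.ResidueField (v.adicCompletionIntegers K)) : ℕ) : ZMod 3)⁻¹) =
          m' + ∑ v ∈ T, 3 ^ c v * (eulerFactorModP (W'.baseChange K) 3 v).rootMultiplicity
              (((Nat.card (IsLocalRing.ResidueField (v.adicCompletionIntegers K)) : ℕ) : ZMod 3)⁻¹) := by
  haveI : Fact (Nat.Prime 3) := ⟨Nat.prime_three⟩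
  unfold SigmaCongruenceAtThree
  constructor
  · intro hA W _ _ W' _ _ N N' _ _ K _ _ Dt Dt' hO6 hsurj hrk hN hmod haddv hN' hK hH hH' κ hκ γ _ 𝔭 h𝔭 hram
      hdeg 𝔭' h𝔭' hne ι' hι ΩK Ωp L hΩK hΩp hL ΩK' Ωp' L' hΩK' hΩp' hL' hi' T c hT hc
    obtain ⟨e, u, hu, he, hcong⟩ := hA W W' N N' K Dt Dt' hO6 hsurj hrk hN hmod haddv hN' hK hH hH' κ hκ γ 𝔭 h𝔭
      hram hdeg 𝔭' h𝔭' hne ι' hι ΩK Ωp L hΩK hΩp hL ΩK' Ωp' L' hΩK' hΩp' hL' hi' T c hT hc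
    have hT3 := not_mem_of_coe_eq hT
    obtain ⟨m, m', hm, hm', hsum⟩ := exists_normProfile_of_sigmaCongruence (W.baseChange K) (W'.baseChange K)
      T hT3 e (fun v hv ↦ (he v hv).1) hi' hu hcong
    refine ⟨m, m', hm, hm', ?_⟩
    -- `d_v · 3^{v(e_v)} = 3^{c_v} · d_v` place by place
    have key : ∀ E : WeierstrassCurve K,
        ∑ v ∈ T, (eulerFactorModP E 3 v).rootMultiplicity
              (((Nat.card (IsLocalRing.ResidueField (v.adicCompletionIntegers K)) : ℕ) : ZMod 3)⁻¹) *
            3 ^ (e v).valuation =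
          ∑ v ∈ T, 3 ^ c v * (eulerFactorModP E 3 v).rootMultiplicity
              (((Nat.card (IsLocalRing.ResidueField (v.adicCompletionIntegers K)) : ℕ) : ZMod 3)⁻¹) :=
      fun E ↦ Finset.sum_congr rfl fun v hv ↦ by rw [(he v hv).2, mul_comm]
    rw [key, key] at hsum
    exact hsum
  · intro hIP W _ _ W' _ _ N N' _ _ K _ _ Dt Dt' hO6 hsurj hrk hN hmod haddv hN' hK hH hH' κ hκ γ _ 𝔭 h𝔭 hram
      hdeg 𝔭' h𝔭' hne ι' hι ΩK Ωp L hΩK hΩp hL ΩK' Ωp' L' hΩK' hΩp' hL' hi' T c hT hc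
    obtain ⟨m, m', hm, hm', hsum⟩ := hIP W W' N N' K Dt Dt' hO6 hsurj hrk hN hmod haddv hN' hK hH hH' κ hκ γ 𝔭
      h𝔭 hram hdeg 𝔭' h𝔭' hne ι' hι ΩK Ωp L hΩK hΩp hL ΩK' Ωp' L' hΩK' hΩp' hL' hi' T c hT hc
    have hT3 := not_mem_of_coe_eq hT
    -- the canonical exponents `e_v := 3^{c_v}`
    have he : ∀ v ∈ T, (3 : ℤ_[3]) ^ c v ≠ 0 ∧ ((3 : ℤ_[3]) ^ c v).valuation = c v :=
      fun v _ ↦ pow_three_ne_zero_and_valuation (c v)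
    have key : ∀ E : WeierstrassCurve K,
        ∑ v ∈ T, (eulerFactorModP E 3 v).rootMultiplicity
              (((Nat.card (IsLocalRing.ResidueField (v.adicCompletionIntegers K)) : ℕ) : ZMod 3)⁻¹) *
            3 ^ ((3 : ℤ_[3]) ^ c v).valuation =
          ∑ v ∈ T, 3 ^ c v * (eulerFactorModP E 3 v).rootMultiplicity
              (((Nat.card (IsLocalRing.ResidueField (v.adicCompletionIntegers K)) : ℕ) : ZMod 3)⁻¹) :=
      fun E ↦ Finset.sum_congr rfl fun v _ ↦ by rw [(pow_three_ne_zero_and_valuation (c v)).2, mul_comm]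
    have hsum' := hsum
    rw [← key, ← key] at hsum'
    obtain ⟨u, hu, hcong⟩ := exists_isUnit_sigmaCongruence_of_normProfile (W.baseChange K) (W'.baseChange K) T
      hT3 (fun v ↦ (3 : ℤ_[3]) ^ c v) (fun v hv ↦ (he v hv).1) hm hm' hsum'
    exact ⟨fun v ↦ (3 : ℤ_[3]) ^ c v, u, hu, he, hcong⟩


/-! ### §5 Given Hsieh's Theorem B (print, by name) A ⟺ the pure λ-IDENTITY -/

/-- **Modulo PRINT, A is the Σ-depleted λ-identity and nothing else.** Granted the refereed named fact
`Hsieh2014.thmB_exists_isHsiehLFunction_coeff_norm_eq_one_unrPeriod_anyLevel` (Hsieh, Doc. Math. 19 (2014)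
Thm. B, typed at any level; it gives `μ(𝓛) = 0` for EVERY `R₀`-frame of `f_E` itself at the wild split prime —
utd-p1 g4's `UniversalToricDescentSelfMuZero.self_forall_isBDPLFunction_coeff_norm_eq_one`), the route decl
`SigmaCongruenceAtThree` (stmt-27120) is EQUIVALENT to the ∀-form λ-IDENTITY on the same binders:
«for all norm profiles `m` of `𝓛` and `m′` of `𝓛′`: `m + Σ_{v∈T} 3^{c_v}·d_v(E_K) = m′ + Σ_{v∈T} 3^{c_v}·d_v(E′_K)`»,
i.e. `λ(𝓛^Σ_E) = λ(𝓛^Σ_{E′})` for the Σ-depletions along the bad set `T` — Greenberg–Vatsal (1.5)'s λ-part for the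
BDP frames of the `3`-congruent pair at `27 ∣ N`. (→ needs no print: §4 and uniqueness of profiles; ← : §4 with the
profiles supplied by `hB` for `𝓛` and by the hypothesis `μ(𝓛′) = 0` for `𝓛′`.) CONDITIONAL on `hB` (displayed);
A stays OPEN. [cite: GreenbergVatsal2000, Thm. (1.5), §1 display (9)] [cite: Hsieh2014, Thm. B (Doc. Math. 19 p. 712)]
[cite: LeiMullerXia2023, Cor. 3.8, Thm. B] -/
theorem sigmaCongruenceAtThree_iff_lambdaIdentity_of_thmB
    (hB : Literature.NumberTheory.EllipticCurves.Hsieh2014.thmB_exists_isHsiehLFunction_coeff_norm_eq_one_unrPeriod_anyLevel) :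
    SigmaCongruenceAtThree ↔
      ∀ (W : WeierstrassCurve ℚ) [W.IsElliptic] [W.IsGloballyMinimal] (W' : WeierstrassCurve ℚ) [W'.IsElliptic]
      [W'.IsGloballyMinimal] (N N' : ℕ) [NeZero N] [NeZero N'] (K : Type) [Field K] [NumberField K] (Dt :
      Literature.NumberTheory.EllipticCurves.ModularForms.ModularParametrizationData W N) (Dt' :
      Literature.NumberTheory.EllipticCurves.ModularForms.ModularParametrizationData W' N'),
      Summit.BirchSwinnertonDyer.Rank1Residual.Additive.ClassO6 W 3 → W.HasSurjectiveModNGaloisRep 3 →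
      W.analyticRank = 1 → W.conductorNorm ℤ = N → Summit.BirchSwinnertonDyer.Rank1Residual.O6.ModPCongruent W' W
      3 → ¬ Literature.NumberTheory.EllipticCurves.Rank1Residual.Addv W' 3 → W'.conductorNorm ℤ = N' →
      Literature.NumberTheory.EllipticCurves.IsImaginaryQuadratic K →
      Literature.NumberTheory.EllipticCurves.SatisfiesHeegnerHypothesis N K →
      Literature.NumberTheory.EllipticCurves.SatisfiesHeegnerHypothesis N' K → ∀ (κ :
      Literature.NumberTheory.EllipticCurves.ZpExtension K 3), κ.IsAnticyclotomic → ∀ (γ :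
      Field.absoluteGaloisGroup K) [Fact (κ.IsTopGenerator γ)] (𝔭 : IsDedekindDomain.HeightOneSpectrum
      (NumberField.RingOfIntegers K)), ((3 : ℕ) : NumberField.RingOfIntegers K) ∈ 𝔭.asIdeal →
      𝔭.asIdeal.ramificationIdx (NumberField.RingOfIntegers ℚ) = 1 → 𝔭.asIdeal.inertiaDeg
      (NumberField.RingOfIntegers ℚ) = 1 → ∀ (𝔭' : IsDedekindDomain.HeightOneSpectrum (NumberField.RingOfIntegers
      K)), ((3 : ℕ) : NumberField.RingOfIntegers K) ∈ 𝔭'.asIdeal → 𝔭' ≠ 𝔭 → ∀ (ι' : PadicAlgCl 3 ≃+* ℂ),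
      Summit.BirchSwinnertonDyer.BirchSwinnertonDyer.Theorems.SchneiderFree.BranchInducesPrime 3 ι' 𝔭 → ∀ (ΩK : ℂ)
      (Ωp : ℂ_[3]) (L : Literature.NumberTheory.EllipticCurves.UnrSeries 3), ΩK ≠ 0 → Ωp ≠ 0 →
      Literature.NumberTheory.EllipticCurves.IsBDPLFunction ι' 𝔭 κ γ Dt.f ΩK Ωp L → ∀ (ΩK' : ℂ) (Ωp' : ℂ_[3]) (L'
      : Literature.NumberTheory.EllipticCurves.UnrSeries 3), ΩK' ≠ 0 → Ωp' ≠ 0 →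
      Literature.NumberTheory.EllipticCurves.IsBDPLFunction ι' 𝔭 κ γ Dt'.f ΩK' Ωp' L' → (∃ i : ℕ,
      ‖((PowerSeries.coeff i L' : Literature.NumberTheory.EllipticCurves.unrIntegers 3) : ℂ_[3])‖ = 1) → ∀ (T :
      Finset (IsDedekindDomain.HeightOneSpectrum (NumberField.RingOfIntegers K))) (c :
      IsDedekindDomain.HeightOneSpectrum (NumberField.RingOfIntegers K) → ℕ), (↑T = {v :
      IsDedekindDomain.HeightOneSpectrum (NumberField.RingOfIntegers K) | ((3 : ℕ) : NumberField.RingOfIntegers K)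
      ∉ v.asIdeal ∧ (¬ (W.baseChange K).HasGoodReductionAt v ∨ ¬ (W'.baseChange K).HasGoodReductionAt v)}) → (∀ v
      ∈ T, (∃ d₀ : Literature.NumberTheory.EllipticCurves.GreenbergSelmer.decomp (K := K) v, (κ (d₀ :
      Field.absoluteGaloisGroup K)).toAdd = (3 : ℤ_[3]) ^ c v) ∧ (∀ d :
      Literature.NumberTheory.EllipticCurves.GreenbergSelmer.decomp (K := K) v, (3 : ℤ_[3]) ^ c v ∣ (κ (d :
      Field.absoluteGaloisGroup K)).toAdd)) →
      ∀ m m' : ℕ,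
        ((∀ i < m, ‖((PowerSeries.coeff i L : unrIntegers 3) : ℂ_[3])‖ < 1) ∧
          ‖((PowerSeries.coeff m L : unrIntegers 3) : ℂ_[3])‖ = 1) →
        ((∀ i < m', ‖((PowerSeries.coeff i L' : unrIntegers 3) : ℂ_[3])‖ < 1) ∧
          ‖((PowerSeries.coeff m' L' : unrIntegers 3) : ℂ_[3])‖ = 1) →
        m + ∑ v ∈ T, 3 ^ c v * (eulerFactorModP (W.baseChange K) 3 v).rootMultiplicity
              (((Nat.card (IsLocalRing.ResidueField (v.adicCompletionIntegers K)) : ℕ) : ZMod 3)⁻¹) =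
          m' + ∑ v ∈ T, 3 ^ c v * (eulerFactorModP (W'.baseChange K) 3 v).rootMultiplicity
              (((Nat.card (IsLocalRing.ResidueField (v.adicCompletionIntegers K)) : ℕ) : ZMod 3)⁻¹) := by
  haveI : Fact (Nat.Prime 3) := ⟨Nat.prime_three⟩
  rw [sigmaCongruenceAtThree_iff_invariantPair]
  constructor
  · intro hIP W _ _ W' _ _ N N' _ _ K _ _ Dt Dt' hO6 hsurj hrk hN hmod haddv hN' hK hH hH' κ hκ γ _ 𝔭 h𝔭 hram
      hdeg 𝔭' h𝔭' hne ι' hι ΩK Ωp L hΩK hΩp hL ΩK' Ωp' L' hΩK' hΩp' hL' hi' T c hT hc m m' hm hm'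
    obtain ⟨m₀, m₀', hm₀, hm₀', hsum⟩ := hIP W W' N N' K Dt Dt' hO6 hsurj hrk hN hmod haddv hN' hK hH hH' κ hκ γ
      𝔭 h𝔭 hram hdeg 𝔭' h𝔭' hne ι' hι ΩK Ωp L hΩK hΩp hL ΩK' Ωp' L' hΩK' hΩp' hL' hi' T c hT hc
    rw [UniversalToricDescentSelfMuZero.normProfile_unique hm hm₀,
      UniversalToricDescentSelfMuZero.normProfile_unique hm' hm₀']
    exact hsum
  · intro hΛ W _ _ W' _ _ N N' _ _ K _ _ Dt Dt' hO6 hsurj hrk hN hmod haddv hN' hK hH hH' κ hκ γ _ 𝔭 h𝔭 hram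
      hdeg 𝔭' h𝔭' hne ι' hι ΩK Ωp L hΩK hΩp hL ΩK' Ωp' L' hΩK' hΩp' hL' hi' T c hT hc
    -- `μ(𝓛) = 0` from print (Hsieh Thm. B via the self-`μ` theorem), `μ(𝓛′) = 0` is the hypothesis `hi'`
    obtain ⟨m, hm⟩ := UniversalToricDescentSelfMuZero.exists_normProfile_of_exists_coeff_norm_eq_one
      (UniversalToricDescentSelfMuZero.self_forall_isBDPLFunction_coeff_norm_eq_one hB W N K Dt hO6 hsurj hrk hN
        hK hH κ hκ γ 𝔭 h𝔭 hram hdeg 𝔭' h𝔭' hne ι' hι ΩK Ωp L hΩK hΩp hL)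
    obtain ⟨m', hm'⟩ := UniversalToricDescentSelfMuZero.exists_normProfile_of_exists_coeff_norm_eq_one hi'
    exact ⟨m, m', hm, hm', hΛ W W' N N' K Dt Dt' hO6 hsurj hrk hN hmod haddv hN' hK hH hH' κ hκ γ 𝔭 h𝔭 hram hdeg
      𝔭' h𝔭' hne ι' hι ΩK Ωp L hΩK hΩp hL ΩK' Ωp' L' hΩK' hΩp' hL' hi' T c hT hc m m' hm hm'⟩

end Summit.BirchSwinnertonDyer.BirchSwinnertonDyer.Theorems.UniversalToricDescentSigmaCongruenceInvariantPair

end
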